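/-
COR-CM (cell pub-hodgecm2, stage 2 of the Hodge ladder) — count-neutral KERNEL COMBINATORICS «β − 1 faces for every Galois CM field of dicyclic type,
EVERY finite abelian A» (seat prover-pub-hodgecm2-b23-g43-0, binder prover b23, gen 43; claim DICYCLIC-EVEN, HOME/INBOX.md l.10881).
Theorems only; no geometry beyond the tree's `Face` / `faceOfG`, no `Universe` field touched, no named fact, nothing asserted; the lane
`Census/DicyclicTwist*` (this seat, gens 42–43), the generic transfer `CorCM/FaceGenerationTransfer.lean`, gen 42's field file
`CorCM/FaceDicyclicTwistGeneration.lean`, this seat's `CorCM/FaceDicyclicTwistDatum.lean` and the INT2-GEN socket (`CorCM/FacePeriodsGeneratingSet.lean`)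
are used BY NAME; `Interfaces.lean` (C1),
every E term, B01, `Transposition/*`, `PortJoin/*` are untouched.
HONEST FRAMING (COORDINATOR RULING — HODGE FRAMING CORRECTION, 2026-08-21T11:55:35Z): `HC_CM` is NOT proved, here or anywhere in the tree;
this file produces no period and proves no face period for any field; its `HodgeConjectureFor` statements are CONDITIONAL on face periods.
T5: n/a-class — the only Prop hypothesis binders displayed are the dicyclic datum (its `Aut`-form equations, or §3's index-two subgroup `H ∋ c` with
`g² = c` off `H`, `h² ≠ c` on `H`, `12 ≤ [F:ℚ]`), `3 ≤ |A|` (resp. `|A| = 4`, `2A = 0`) and INT2-GEN's period hypothesis on the produced face set (§4); no named-fact / conjecture-def binder; checker: self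
(prover-pub-hodgecm2-b23-g43-0), 2026-08-23.
-/
import Summits.HodgeConjecture.CorCM.Census.DicyclicTwistLaw
import Summits.HodgeConjecture.CorCM.FaceDicyclicTwistGeneration
import Summits.HodgeConjecture.CorCM.FaceDicyclicTwistDatum
import HarnessLib

/-!
# Galois CM fields of dicyclic type over ANY finite abelian group: EXACTLY `β − 1` generating rank-four faces

Gen 42's `CorCM/FaceDicyclicTwistGeneration.lean` proved, for `F` Galois CM whose Galois translates carry a dicyclic datum
`D : DicyclicTwist.Datum (GalT F) conjT A` (`Gal(F/ℚ) ≅ Dic(ℤ/2 × A, c)`, complex conjugation `c = x²` a square, `[F:ℚ] = 4|A|`), that the least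
size of a face set satisfying INT2-GEN's generation binder is EXACTLY `β(F) − 1` — under the hypothesis `|A|` ODD.  This file removes the parity
hypothesis: the statement holds for EVERY finite abelian `A` with `|A| ≥ 3`, in particular for the `2`-power dicyclic-type groups
(`A = ℤ/4`: `G = ℤ/4 ⋊ ℤ/4` of order `16`; `A = (ℤ/2)²`: the ABELIAN group `G = ℤ/4 × (ℤ/2)²` with `c = (2,0,0)` a square — outside the
abelian-datum slices of `CorCM/FaceAbelian*`, which need `c ∉ Aut²`) where complex conjugation is a square but `x` no longer has odd co-order.

* §1 **`isLeast_card_faces_hgen_of_dicyclic'`** / **`exists_faces_hgen_of_dicyclic'`**: for every base embedding `σ₀` the least size of a finite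
  set `𝒮` of rank-four faces of `F` with `hgen(𝒮, σ₀)` is **EXACTLY `β(F) − 1`**, `β(F) = #Block conjT`.  Existence is the dicyclic law of
  `Census/DicyclicTwistLaw.lean` (`DicyclicTwist.exists_gfaces_generate'`: for `|A|` even the strict-half functionals `UE, UX, SE₀, SE₁` of
  `Census/DicyclicTwistEven*.lean`, one rule face per non-residual block and the two closing squares; for `|A|` odd gen 42); the floor is the
  parity-free stabiliser floor of `Census/DicyclicTwistStabiliser.lean` (`𝒦(G,c) = ι(ℤ/2 × A)`, so `d₂ = 1` and `φ₂ + 1 = β` by lit-andre-3's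
  `Census/TypeStabiliserCharK.lean` and seat b09's coinvariant floor `Census/CoinvariantFloor.lean`); both are carried to the field by
  `CorCM/FaceGenerationTransfer.lean` (`FaceTransfer.isLeast_card_faces_hgen_of_intrinsic`).
* §1 (cont.) the first EVEN rows: `A = ℤ/4` (degree `16`, `G = ℤ/4 ⋊ ℤ/4`): EXACTLY `18` faces (`β = 19`); `A = (ℤ/2)²` (degree `16`,
  `G = ℤ/4 × (ℤ/2)²`, `c = (2,0,0)`): EXACTLY `21` faces (`β = 22`) (`Census/DicyclicTwistBlockCountEven.lean`); `A = ℤ/6` (degree `24`,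
  `G = Dic₃ × ℤ/2`, `c = x²`): EXACTLY `177` faces (`β = 178`, `Census/DicyclicTwistLaw.lean`).
* §2 the `Aut`-datum form (`exists_faces_hgen_of_dicyclic_aut'`, via gen 42's `exists_datum_of_aut`).
* §3 **DATUM-FREE** (`isLeast_card_faces_hgen_of_index_two` on `GalT F`, `isLeast_card_faces_hgen_of_index_two_aut` on `Aut F` with the
  conjugation automorphism `c₀` at `σ₀`; the datum comes from `CorCM/FaceDicyclicTwistDatum.lean` `exists_datum_of_index_two`): for `F` Galois CM of
  degree `≥ 12` whose Galois group has a subgroup `H` of index `2` containing complex conjugation `c` with `g² = c` for every `g ∉ H` and `h² ≠ c`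
  for every `h ∈ H` (e.g. `ℤ/4 ⋊ ℤ/4` with `c = y²`, `H = ⟨a, y²⟩`; `ℤ/4 × (ℤ/2)²` with `c = (2,0,0)`; `Dic_m`; `Dic₃ × ℤ/2`), the least size of a face
  set with `hgen(𝒮, σ₀)` is **EXACTLY `β(F) − 1`**.
* §4 **`hodgeConjectureFor_of_dicyclic_of_exists_facePeriod'`** (INT2-GEN socket BY NAME): a face set with `|𝒮| + 1 = β(F)` EXISTS whose periods on
  the universe of record give the Hodge conjecture for every abelian variety dominated by a product of CM abelian varieties with CM by subfields of
  `F` — CONDITIONAL on those periods; `HC_CM` is NOT proved.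

References: [cite: Pohlmann1968, Thm. 1]; [cite: Milne1999LefschetzClasses, Thm. 3.2, Prop. 2.1]; [cite: Shimura1998, §6.2 Theorem 3 and §6.1
Corollary of Theorem 2 (pp. 41–43), §8.1 (p. 62)]; [cite: MumfordAV1970, §19 Thm. 1 and p. 169].
-/

noncomputable section

open CategoryTheory NumberField NumberField.ComplexEmbedding
open Literature.AlgebraicGeometry Literature.AlgebraicGeometry.Motives Literature.AlgebraicGeometry.HodgeTheory
open Literature.AlgebraicGeometry.ComplexMultiplication Literature.AlgebraicGeometry.Milne1999
open Literature.NumberTheory.Automorphic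
open Literature.NumberTheory.Automorphic.PicardCM
open Summit.HodgeConjecture.CorCM.Domination

namespace Summit.HodgeConjecture.CorCM.FaceDicyclicTwist

open Summit.HodgeConjecture.CorCM.Prior.AllgGroup.RfwfAllgGroup
open Summit.HodgeConjecture.CorCM.Census.BlockParity
open Summit.HodgeConjecture.CorCM.Census.Coinvariant
open Summit.HodgeConjecture.CorCM.Census

/-! ## §1 Dicyclic datum on the Galois translates, any `A`: exactly `β(F) − 1` generating faces -/

section Field

variable {F : Type} [Field F] [NumberField F]
variable {A : Type} [AddCommGroup A] [Fintype A] [DecidableEq A]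

/-- **EVERY GALOIS CM FIELD OF DICYCLIC TYPE HAS `β − 1` GENERATING FACES, AND NONE FEWER — for EVERY finite abelian `A` with `|A| ≥ 3`**:
for `F` Galois CM with a dicyclic datum `D` on `GalT F` over `A` and any base embedding `σ₀`, the least size of a face set `𝒮` with `hgen(𝒮, σ₀)`
is EXACTLY `β(F) − 1` (`FaceTransfer.isLeast_card_faces_hgen_of_intrinsic` on `DicyclicTwist.exists_gfaces_generate'` /
`DicyclicTwist.card_block_le_card_add_one_of_subset_hodgeSpan`). [folklore] -/
theorem isLeast_card_faces_hgen_of_dicyclic' [IsCMField F] [IsGalois ℚ F] (D : DicyclicTwist.Datum (GalT F) conjT A)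
    (h3 : 3 ≤ Fintype.card A) (σ₀ : F →+* ℂ) :
    IsLeast {m : ℕ | ∃ 𝒮 : Finset (Face F), 𝒮.card = m ∧
      ∀ f : Face F, lefChar f.corner (fun _ => ({σ₀} : Finset (F →+* ℂ))) ∈ AddSubgroup.closure
        {a : Asym F | ∃ g ∈ (𝒮 : Set (Face F)), ∃ σ : F →+* ℂ, a = lefChar g.corner (fun _ => ({σ} : Finset (F →+* ℂ)))}}
      (Fintype.card (Block (conjT : GalT F)) - 1) := by
  refine FaceTransfer.isLeast_card_faces_hgen_of_intrinsic _ ?_ (fun S₀ hS₀ hS => ?_) σ₀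
  · obtain ⟨S, hS, hcard, hgen⟩ := DicyclicTwist.exists_gfaces_generate' D conjT_mul_self h3
    exact ⟨S, hS, by omega, hgen⟩
  · have h := DicyclicTwist.card_block_le_card_add_one_of_subset_hodgeSpan D conjT_mul_self S₀ hS₀
      (fun y hy => hS (gfaceSet_subset_hodgeSpan conjT conjT_mul_self hy))
    omega

omit [DecidableEq A] in
/-- **The field-level floor, any `A`**: every face set `𝒮` with `hgen(𝒮, σ₀)` has `β(F) ≤ |𝒮| + 1`. [folklore] -/
theorem card_block_le_card_add_one_of_hgen' [IsCMField F] [IsGalois ℚ F] (D : DicyclicTwist.Datum (GalT F) conjT A)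
    (𝒮 : Finset (Face F)) (σ₀ : F →+* ℂ)
    (hgen : ∀ f : Face F, lefChar f.corner (fun _ => ({σ₀} : Finset (F →+* ℂ))) ∈ AddSubgroup.closure
      {a : Asym F | ∃ g ∈ (𝒮 : Set (Face F)), ∃ σ : F →+* ℂ, a = lefChar g.corner (fun _ => ({σ} : Finset (F →+* ℂ)))}) :
    Fintype.card (Block (conjT : GalT F)) ≤ 𝒮.card + 1 := by
  have h := FaceTransfer.le_card_of_hgen_of_floor (Fintype.card (Block (conjT : GalT F)) - 1) (fun S₀ hS₀ hS => by
    have h := DicyclicTwist.card_block_le_card_add_one_of_subset_hodgeSpan D conjT_mul_self S₀ hS₀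
      (fun y hy => hS (gfaceSet_subset_hodgeSpan conjT conjT_mul_self hy))
    omega) 𝒮 σ₀ hgen
  omega

/-- **Existence with the exact count, any `A` with `|A| ≥ 3`**: a face set `𝒮` with `|𝒮| + 1 = β(F)` and `hgen(𝒮, σ₀)`. [folklore] -/
theorem exists_faces_hgen_of_dicyclic' [IsCMField F] [IsGalois ℚ F] (D : DicyclicTwist.Datum (GalT F) conjT A)
    (h3 : 3 ≤ Fintype.card A) (σ₀ : F →+* ℂ) :
    ∃ 𝒮 : Finset (Face F), 𝒮.card + 1 = Fintype.card (Block (conjT : GalT F)) ∧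
      ∀ f : Face F, lefChar f.corner (fun _ => ({σ₀} : Finset (F →+* ℂ))) ∈ AddSubgroup.closure
        {a : Asym F | ∃ g ∈ (𝒮 : Set (Face F)), ∃ σ : F →+* ℂ, a = lefChar g.corner (fun _ => ({σ} : Finset (F →+* ℂ)))} := by
  obtain ⟨⟨𝒮, hcard, hgen⟩, -⟩ := isLeast_card_faces_hgen_of_dicyclic' D h3 σ₀
  have hfloor := card_block_le_card_add_one_of_hgen' D 𝒮 σ₀ hgen
  obtain ⟨S, -, hS1, -⟩ := DicyclicTwist.exists_gfaces_generate' D conjT_mul_self h3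
  exact ⟨𝒮, by omega, hgen⟩

/-- **`A = ℤ/4` (group `ℤ/4 ⋊ ℤ/4` of order `16`, degree `16`): EXACTLY `18` generating faces** (`β = 19`; the first EVEN dicyclic row). [folklore] -/
theorem isLeast_card_faces_hgen_eighteen [IsCMField F] [IsGalois ℚ F] (D : DicyclicTwist.Datum (GalT F) conjT (ZMod 4)) (σ₀ : F →+* ℂ) :
    IsLeast {m : ℕ | ∃ 𝒮 : Finset (Face F), 𝒮.card = m ∧
      ∀ f : Face F, lefChar f.corner (fun _ => ({σ₀} : Finset (F →+* ℂ))) ∈ AddSubgroup.closure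
        {a : Asym F | ∃ g ∈ (𝒮 : Set (Face F)), ∃ σ : F →+* ℂ, a = lefChar g.corner (fun _ => ({σ} : Finset (F →+* ℂ)))}} 18 := by
  have h := isLeast_card_faces_hgen_of_dicyclic' D (by rw [ZMod.card]; norm_num) σ₀
  rwa [DicyclicTwist.card_block_eq_nineteen D conjT_mul_self] at h

/-- **`A = (ℤ/2)²` (elementary abelian, degree `16`): EXACTLY `21` generating faces** (`β = 22`). [folklore] -/
theorem isLeast_card_faces_hgen_twentyOne [IsCMField F] [IsGalois ℚ F] (D : DicyclicTwist.Datum (GalT F) conjT A)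
    (h4 : Fintype.card A = 4) (h2 : ∀ s : A, s + s = 0) (σ₀ : F →+* ℂ) :
    IsLeast {m : ℕ | ∃ 𝒮 : Finset (Face F), 𝒮.card = m ∧
      ∀ f : Face F, lefChar f.corner (fun _ => ({σ₀} : Finset (F →+* ℂ))) ∈ AddSubgroup.closure
        {a : Asym F | ∃ g ∈ (𝒮 : Set (Face F)), ∃ σ : F →+* ℂ, a = lefChar g.corner (fun _ => ({σ} : Finset (F →+* ℂ)))}} 21 := by
  have h := isLeast_card_faces_hgen_of_dicyclic' D (by omega) σ₀
  rwa [DicyclicTwist.card_block_eq_twentyTwo D conjT_mul_self h4 h2] at h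

/-- **`A = ℤ/6` (group `Dic₃ × ℤ/2` of order `24` with complex conjugation `x²` inside the `Dic₃` factor, degree `24`): EXACTLY `177` generating
faces** (`β = 178`; a degree-`24` row beyond the certified atlas). [folklore] -/
theorem isLeast_card_faces_hgen_oneHundredSeventySeven [IsCMField F] [IsGalois ℚ F] (D : DicyclicTwist.Datum (GalT F) conjT (ZMod 6))
    (σ₀ : F →+* ℂ) :
    IsLeast {m : ℕ | ∃ 𝒮 : Finset (Face F), 𝒮.card = m ∧
      ∀ f : Face F, lefChar f.corner (fun _ => ({σ₀} : Finset (F →+* ℂ))) ∈ AddSubgroup.closure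
        {a : Asym F | ∃ g ∈ (𝒮 : Set (Face F)), ∃ σ : F →+* ℂ, a = lefChar g.corner (fun _ => ({σ} : Finset (F →+* ℂ)))}} 177 := by
  have h := isLeast_card_faces_hgen_of_dicyclic' D (by rw [ZMod.card]; norm_num) σ₀
  rwa [DicyclicTwist.card_block_eq_oneHundredSeventyEight D conjT_mul_self] at h

/-! ## §2 The `Aut`-datum form -/

/-- **`Aut`-datum form of the count, any `A` with `|A| ≥ 3`**: a face set with `|𝒮| + 1 = β(F)` and `hgen(𝒮, σ₀)` (gen 42's
`exists_datum_of_aut`). [folklore] -/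
theorem exists_faces_hgen_of_dicyclic_aut' [IsCMField F] [IsGalois ℚ F] (σ₀ : F →+* ℂ) (ι₀ : ZMod 2 × A → (F ≃ₐ[ℚ] F)) (x₀ : F ≃ₐ[ℚ] F)
    (hι : ∀ a b, ι₀ (a + b) = ι₀ a * ι₀ b) (hcσ : σ₀.comp ((ι₀ (1, 0) : F ≃ₐ[ℚ] F) : F →+* F) = conjugate σ₀)
    (hx : ∀ a, x₀ * ι₀ a = ι₀ (-a) * x₀) (hxx : x₀ * x₀ = ι₀ (1, 0)) (hinj : Function.Injective ι₀) (hne : ∀ a, x₀ ≠ ι₀ a)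
    (hcard : Module.finrank ℚ F = 4 * Fintype.card A) (h3 : 3 ≤ Fintype.card A) :
    ∃ 𝒮 : Finset (Face F), 𝒮.card + 1 = Fintype.card (Block (conjT : GalT F)) ∧
      ∀ f : Face F, lefChar f.corner (fun _ => ({σ₀} : Finset (F →+* ℂ))) ∈ AddSubgroup.closure
        {a : Asym F | ∃ g ∈ (𝒮 : Set (Face F)), ∃ σ : F →+* ℂ, a = lefChar g.corner (fun _ => ({σ} : Finset (F →+* ℂ)))} := by
  obtain ⟨D⟩ := exists_datum_of_aut σ₀ ι₀ x₀ hι hcσ hx hxx hinj hne hcard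
  exact exists_faces_hgen_of_dicyclic' D h3 σ₀

end Field

/-! ## §3 Datum-free: exactly `β(F) − 1` faces from an index-two subgroup of the Galois group -/

section IndexTwo

variable {F : Type} [Field F] [NumberField F]

/-- **DICYCLIC TYPE, DATUM-FREE (on the Galois translates)**: for `F` Galois CM of degree `≥ 12` and a subgroup `H ≤ GalT F` of index `2`
containing complex conjugation such that every translate outside `H` squares to complex conjugation and no translate inside `H` does, the least
size of a face set `𝒮` with `hgen(𝒮, σ₀)` is EXACTLY `β(F) − 1`. [folklore] -/
theorem isLeast_card_faces_hgen_of_index_two [IsCMField F] [IsGalois ℚ F] (H : Subgroup (GalT F)) (hH : H.index = 2)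
    (hc : (conjT : GalT F) ∈ H) (hsq : ∀ g, g ∉ H → g * g = conjT) (hns : ∀ h ∈ H, h * h ≠ conjT)
    (h12 : 12 ≤ Module.finrank ℚ F) (σ₀ : F →+* ℂ) :
    IsLeast {m : ℕ | ∃ 𝒮 : Finset (Face F), 𝒮.card = m ∧
      ∀ f : Face F, lefChar f.corner (fun _ => ({σ₀} : Finset (F →+* ℂ))) ∈ AddSubgroup.closure
        {a : Asym F | ∃ g ∈ (𝒮 : Set (Face F)), ∃ σ : F →+* ℂ, a = lefChar g.corner (fun _ => ({σ} : Finset (F →+* ℂ)))}}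
      (Fintype.card (Block (conjT : GalT F)) - 1) := by
  obtain ⟨A, _, _, _, ⟨D⟩⟩ := exists_datum_of_index_two H hH hc hsq hns
  have h4 := finrank_eq_four_mul_card D
  exact isLeast_card_faces_hgen_of_dicyclic' D (by omega) σ₀

/-- **DICYCLIC TYPE, DATUM-FREE (on `Aut F`)**: for `F` Galois CM of degree `≥ 12`, `c₀` the automorphism inducing complex conjugation at `σ₀`,
and a subgroup `H ≤ Aut F` of index `2` with `c₀ ∈ H`, `g² = c₀` for every `g ∉ H` and `h² ≠ c₀` for every `h ∈ H` (e.g. `ℤ/4 ⋊ ℤ/4` with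
`c₀ = y²`, `H = ⟨a, y²⟩`; `ℤ/4 × (ℤ/2)²` with `c₀ = (2,0,0)`; `Dic_m`; `Dic₃ × ℤ/2`), the least size of a face set `𝒮` with `hgen(𝒮, σ₀)` is
EXACTLY `β(F) − 1`. [folklore] -/
theorem isLeast_card_faces_hgen_of_index_two_aut [IsCMField F] [IsGalois ℚ F] (σ₀ : F →+* ℂ) {c₀ : F ≃ₐ[ℚ] F}
    (hcσ : σ₀.comp ((c₀ : F ≃ₐ[ℚ] F) : F →+* F) = conjugate σ₀) (H : Subgroup (F ≃ₐ[ℚ] F)) (hH : H.index = 2) (hc : c₀ ∈ H)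
    (hsq : ∀ g, g ∉ H → g * g = c₀) (hns : ∀ h ∈ H, h * h ≠ c₀) (h12 : 12 ≤ Module.finrank ℚ F) :
    IsLeast {m : ℕ | ∃ 𝒮 : Finset (Face F), 𝒮.card = m ∧
      ∀ f : Face F, lefChar f.corner (fun _ => ({σ₀} : Finset (F →+* ℂ))) ∈ AddSubgroup.closure
        {a : Asym F | ∃ g ∈ (𝒮 : Set (Face F)), ∃ σ : F →+* ℂ, a = lefChar g.corner (fun _ => ({σ} : Finset (F →+* ℂ)))}}
      (Fintype.card (Block (conjT : GalT F)) - 1) := by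
  classical
  obtain ⟨A, _, _, _, ⟨D₀⟩⟩ := exists_datum_of_index_two H hH hc hsq hns
  haveI : Fintype (F ≃ₐ[ℚ] F) := Fintype.ofFinite _
  have hcard : Module.finrank ℚ F = 4 * Fintype.card A := by
    rw [← IsGalois.card_aut_eq_finrank, Nat.card_eq_fintype_card, DicyclicTwist.card_eq_four_mul D₀]
  obtain ⟨D⟩ := exists_datum_of_aut σ₀ D₀.ι D₀.x D₀.map_add (by rw [D₀.map_c]; exact hcσ) D₀.x_mul
    (by rw [D₀.map_c]; exact D₀.x_mul_x) D₀.inj D₀.x_ne hcard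
  exact isLeast_card_faces_hgen_of_dicyclic' D (by omega) σ₀

end IndexTwo

/-! ## §4 The Hodge-conjecture reading through the INT2-GEN socket (conditional on the face periods) -/

variable {A : Type} [AddCommGroup A] [Fintype A] [DecidableEq A]

/-- **HC for the slice of a Galois CM field of dicyclic type, any `A` with `|A| ≥ 3`, from `β − 1` face periods** (INT2-GEN socket BY NAME;
CONDITIONAL on the periods — `HC_CM` is NOT proved): for `K` Galois CM with a dicyclic datum on `GalT K` over `A` there is a face set `𝒮` with
`|𝒮| + 1 = β(K)` (none fewer can satisfy the generation binder) such that, if every face of `𝒮` has a non-vanishing period on the universe of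
record, the Hodge conjecture holds for every abelian variety dominated by a product of CM abelian varieties with CM by subfields of `K`.
[cite: Shimura1998, §6.2 Theorem 3 and §6.1 Corollary of Theorem 2 (pp. 41–43)] [cite: Pohlmann1968, Thm. 1]
[cite: Milne1999LefschetzClasses, Thm. 3.2 and Cor. 4.5] [cite: MumfordAV1970, §19 Thm. 1 and p. 169] -/
theorem hodgeConjectureFor_of_dicyclic_of_exists_facePeriod' (K : CMField) [hGal : IsGalois ℚ K]
    (D : DicyclicTwist.Datum (GalT K) conjT A) (h3 : 3 ≤ Fintype.card A) (σ₀ : (K : Type) →+* ℂ) :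
    ∃ 𝒮 : Finset (Face K), 𝒮.card + 1 = Fintype.card (Block (conjT : GalT K)) ∧
      ((∀ f ∈ 𝒮, ∃ ι₁ : K →+* ℂ, f.Admissible ι₁ ∧ ∃ (V : HermSpace3 K ι₁) (σ : K →+* ℂ),
        (Model.picardCMUniverse exists_isReal_hodgeModel_holds hodgePQ_independent_of_hodgeModel_holds
          BallQuotient.ballQuotientUniformised_holds cmAbelianVarietyRealised_holds).PeriodNV ι₁ V K f.psi σ) →
      ∀ {P B : AbelianVariety ℂ}, AbelianVariety.IsProductOf (fun B : AbelianVariety ℂ =>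
        ∃ (E : Type) (_ : Field E) (_ : NumberField E) (_ : IsCMField E) (_ : E →+* (K : Type)) (Φ : CMType E)
          (ι : 𝓞 E →+* End B) (ϑ : E →+* Module.End ℂ (complexBetti B.X 1)),
          IsCMTypeRealisation Φ B ι ϑ) P →
      AVDominatedBy B P → HodgeConjectureFor B.dim B.X) := by
  obtain ⟨𝒮, hcard, hgen⟩ := exists_faces_hgen_of_dicyclic' (F := K) D h3 σ₀
  refine ⟨𝒮, hcard, fun h P B hP hB => ?_⟩
  have h6 : 6 ≤ Module.finrank ℚ K := le_trans (by norm_num) (twelve_le_finrank (F := K) D h3)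
  exact hodgeConjectureFor_of_avDominatedBy_isProductOf_of_exists_facePeriod_on K h6 (𝒮 : Set (Face K)) σ₀ hgen
    (fun f hf => h f (Finset.mem_coe.mp hf)) hP hB

end Summit.HodgeConjecture.CorCM.FaceDicyclicTwist

end
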